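import Summits.SmoothPoincare4.SmoothPoincare4.Theorems.SymplecticOrigamiGromovRecognitionRelEndLeafSwap
import Summits.SmoothPoincare4.SmoothPoincare4.Theorems.SymplecticOrigamiGromovRecognitionRelEndHelperLimitEmbeddedSphereAux
import Literature.Geometry.Symplectic.JHolomorphicRepresentationFormula
import Literature.Geometry.Symplectic.JHolomorphicIsolatedIntersectionPersists
import Literature.Geometry.Symplectic.JHolomorphicCriticalPointsIsolated
import Literature.Geometry.Symplectic.JSphereMeetsEmbeddedJSphere
import Mathlib.Geometry.Manifold.WhitneyEmbedding

/-!
# Somewhere injective limits of embedded `J`-spheres are embedded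
(registered helper `helper_limitEmbeddedSphere` of line `cross-cap-laurent`, crux `GromovRecognitionRelEnd`,
item stmt-SmoothPoincare4-11009 — the `C1′` replacement of the `J`-curve half of the adjunction fact)

D. McDuff, J. Differential Geom. 34 (1991), §4–§5, (5.5) (double points and critical points of a simple
`J`-curve contribute positively to the self-intersection number, which cannot increase in a limit of
embedded curves); C. Wendl, *Holomorphic Curves in Low Dimensions* (2018), Cor. 2.52.  Here for CLOSED
two-chart spheres, from the tree's DISCHARGED local facts only (persistence of isolated intersections,
no cusps in limits of embedded curves, intersection dichotomy, unique continuation, isolated critical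
points): if embedded `JX`-holomorphic two-chart spheres `(us n, vs n)` converge, as glued maps `Gs n → F` in
`C(ℂℙ¹, X)`, to the glued map `F` of a `JX`-two-chart sphere `(u, v)` which is SOMEWHERE INJECTIVE (a
regular parameter `z₀` whose value has the single preimage `z₀` on the sphere), then `(u, v)` is embedded.
The proof is the sphere version of
`Literature.Geometry.Symplectic.jHolomorphicLimitOfEmbedded_isEmbedded_of_persist_of_noCusp`; its
elementary topology is in `…HelperLimitEmbeddedSphereAux.lean`.
-/

noncomputable section

open scoped Manifold ContDiff Topology
open Set Function Filter
open Literature.Topology.FourManifolds Literature.Topology.FourManifolds.ComplexProjectiveSpace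
open Literature.Geometry.Symplectic Literature.Geometry.Symplectic.LimitEmbedded
open Summit.SmoothPoincare4.SmoothPoincare4.Theorems.GromovRecognitionRelEnd.CrossCapLaurent.GluedBasics

-- the prescribed namespace `Summit.<P>.<Sub>.…` duplicates `SmoothPoincare4` (P = Sub)
set_option linter.dupNamespace false

namespace Summit.SmoothPoincare4.SmoothPoincare4.Theorems.GromovRecognitionRelEnd.CrossCapLaurent


open LimitEmbeddedSphere

/-- **Somewhere injective uniform limits of embedded `J`-two-chart spheres are embedded** (McDuff 1991
§4–§5; registered helper `helper_limitEmbeddedSphere`).  Read the convergence in the two affine charts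
through a Whitney embedding `e : X → ℝᴺ`.  On the (preconnected) regular set of `u` the locus `N₂` of
regular parameters having a PARTNER — another parameter with the same image, or the point at infinity —
is open (intersection dichotomy at the regular branch: an isolated intersection would persist to the
embedded approximants; equal image germs propagate partners) and relatively closed
(`helper_limitEmbeddedSpherePartnerClosed`), and misses `z₀`: it is empty.  A critical point is then an
injective critical germ, excluded by the no-cusp theorem; so `u` is an injective immersion missing `v 0`,
and the no-cusp theorem at the origin of the chart at infinity makes `dv(0)` injective. -/
theorem helper_limitEmbeddedSphere : ∀ (X : Type) [TopologicalSpace X] [T2Space X] [SecondCountableTopology X] [CompactSpace X] [ChartedSpace (EuclideanSpace ℝ (Fin 4)) X] [IsManifold (𝓡 4) ∞ X] (JX : Literature.Geometry.Symplectic.AlmostComplexStructure (𝓡 4) ∞ X) (us vs : ℕ → ℂ → X) (Gs : ℕ → C(Literature.Topology.FourManifolds.ComplexProjectiveSpace 1, X)) (u v : ℂ → X) (F : C(Literature.Topology.FourManifolds.ComplexProjectiveSpace 1, X)), (∀ n, ContMDiff 𝓘(ℝ, ℂ) (𝓡 4) ∞ (us n) ∧ ContMDiff 𝓘(ℝ,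 ℂ) (𝓡 4) ∞ (vs n) ∧ (∀ z : ℂ, z ≠ 0 → vs n z = us n z⁻¹) ∧ Literature.Geometry.Symplectic.IsJHolomorphic (𝓡 4) (fun y => JX y) (us n) ∧ Literature.Geometry.Symplectic.IsJHolomorphic (𝓡 4) (fun y => JX y) (vs n) ∧ Function.Injective (us n) ∧ (∀ z, Function.Injective (mfderiv 𝓘(ℝ, ℂ) (𝓡 4) (us n) z)) ∧ Function.Injective (mfderiv 𝓘(ℝ, ℂ) (𝓡 4) (vs n) 0) ∧ vs n 0 ∉ Set.range (us n) ∧ (∀ p, Literature.Topology.FourManifolds.ComplexProjectiveSpace.CoordNeZero 0 p → Gs n p = us n (Literature.Topology.FourManifolds.ComplexProjectiveSpace.affineCoordComplex 0 p 0)) ∧ (∀ p, Literature.Topology.FourManifolds.ComplexProjectiveSpace.CoordNeZero 1 p → Gs n p = vs n (Literature.Topology.FourManifolds.ComplexProjectiveSpace.affineCoordComplex 1 p 0))) → ContMDiff 𝓘(ℝ, ℂ) (𝓡 4) ∞ u → ContMDiff 𝓘(ℝ, ℂ) (𝓡 4) ∞ v → (∀ z : ℂ, z ≠ 0 → v z =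 u z⁻¹) → Literature.Geometry.Symplectic.IsJHolomorphic (𝓡 4) (fun y => JX y) u → Literature.Geometry.Symplectic.IsJHolomorphic (𝓡 4) (fun y => JX y) v → (∀ p, Literature.Topology.FourManifolds.ComplexProjectiveSpace.CoordNeZero 0 p → F p = u (Literature.Topology.FourManifolds.ComplexProjectiveSpace.affineCoordComplex 0 p 0)) → (∀ p, Literature.Topology.FourManifolds.ComplexProjectiveSpace.CoordNeZero 1 p → F p = v (Literature.Topology.FourManifolds.ComplexProjectiveSpace.affineCoordComplex 1 p 0)) → Filter.Tendsto Gs Filter.atTop (𝓝 F) → (∃ z₀ : ℂ, Function.Injective (mfderiv 𝓘(ℝ, ℂ) (𝓡 4) u z₀) ∧ (∀ z, u z = u z₀ → z = z₀) ∧ v 0 ≠ u z₀) → Function.Injective u ∧ (∀ z, Function.Injective (mfderiv 𝓘(ℝ, ℂ) (𝓡 4) u z)) ∧ Function.Injective (mfderiv 𝓘(ℝ, ℂ) (𝓡 4) v 0) ∧ v 0 ∉ Set.range u := by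
  intro X _ _ _ _ _ _ JX us vs Gs u v F happ hu hv huv hJu hJv hF0 hF1 hlim hsi
  obtain ⟨z₀, hz₀reg, hz₀inj, hz₀inf⟩ := hsi
  -- the local facts (all discharged in the tree) and the almost complex structure
  have hPos : jHolomorphic_isolatedIntersection_persists :=
    jHolomorphic_isolatedIntersection_persists_holds
  have hCusp : jHolomorphic_immersed_of_limitEmbedded_punctured :=
    jHolomorphic_immersed_of_limitEmbedded_punctured_holds
  have hInt : jHolomorphic_intersectionDichotomy := jHolomorphic_intersectionDichotomy_holds
  have hUC : jHolomorphic_uniqueContinuation_const := jHolomorphic_uniqueContinuation_const_holds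
  set J : ∀ y : X, TangentSpace (𝓡 4) y →L[ℝ] TangentSpace (𝓡 4) y := fun y => JX y with hJdef
  have hJ2 : ∀ (x : X) (w : TangentSpace (𝓡 4) x), J x (J x w) = -w := fun x w => JX.map_map x w
  have hJs : ∀ x₀ : X, ContMDiffAt (𝓡 4) 𝓘(ℝ, EuclideanSpace ℝ (Fin 4) →L[ℝ] EuclideanSpace ℝ (Fin 4)) ∞
      (inTangentCoordinates (𝓡 4) (𝓡 4) (id : X → X) id (fun x => J x) x₀) x₀ :=
    fun x₀ => JX.contMDiffAt_inTangentCoordinates x₀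
  -- a Whitney embedding and the convergence in the two charts
  obtain ⟨N, e, he, hemb, hde⟩ := exists_embedding_euclidean_of_compact (I := 𝓡 4) (M := X)
  have hιe : Topology.IsEmbedding e := hemb.isEmbedding
  have hconvU : ∀ D : Set ℂ, TendstoUniformlyOn (fun n z => e (us n z)) (fun z => e (u z)) atTop D := by
    intro D
    have h := (tendstoUniformly_chart he.continuous hlim 0).tendstoUniformlyOn (s := D)
    have e1 : (fun n (z : ℂ) => e (Gs n (mk (homogenize 0 fun _ : Fin 1 => z)))) =
        fun n z => e (us n z) := by
      funext n z; rw [glued_apply_pt_zero (happ n).2.2.2.2.2.2.2.2.2.1]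
    have e2 : (fun (z : ℂ) => e (F (mk (homogenize 0 fun _ : Fin 1 => z)))) = fun z => e (u z) := by
      funext z; rw [glued_apply_pt_zero hF0]
    rwa [e1, e2] at h
  have hconvV : ∀ D : Set ℂ, TendstoUniformlyOn (fun n z => e (vs n z)) (fun z => e (v z)) atTop D := by
    intro D
    have h := (tendstoUniformly_chart he.continuous hlim 1).tendstoUniformlyOn (s := D)
    have e1 : (fun n (z : ℂ) => e (Gs n (mk (homogenize 1 fun _ : Fin 1 => z)))) =
        fun n z => e (vs n z) := by
      funext n z; rw [glued_apply_pt_one (happ n).2.2.2.2.2.2.2.2.2.2]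
    have e2 : (fun (z : ℂ) => e (F (mk (homogenize 1 fun _ : Fin 1 => z)))) = fun z => e (v z) := by
      funext z; rw [glued_apply_pt_one hF1]
    rwa [e1, e2] at h
  -- (0) `u` is nowhere locally constant; neither is `v` at `0`
  have NC : ∀ t : ℂ, ∃ᶠ z in 𝓝 t, u z ≠ u t := by
    intro t
    by_contra h
    have hev : ∀ᶠ z in 𝓝 t, u z = u t := by
      simpa only [Filter.not_frequently, not_not] using h
    have hconst := hUC X J hJ2 hJs u hu hJu t hev
    have hueq : u = fun _ => u t := funext hconst
    have hzero : mfderiv 𝓘(ℝ, ℂ) (𝓡 4) u z₀ = 0 := by rw [hueq]; exact mfderiv_const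
    have hinj := hz₀reg
    rw [hzero] at hinj
    have h10 : (1 : ℂ) = (0 : ℂ) := @hinj (1 : ℂ) (0 : ℂ) (by simp)
    exact one_ne_zero h10
  have NCs : ∀ c : ℂ, ∃ᶠ z in 𝓝 (0 : ℂ), u (z + c) ≠ u (0 + c) := by
    intro c
    have h := NC c
    rw [← map_add_right_nhds_zero c, Filter.frequently_map] at h
    simpa only [zero_add] using h
  have NCv : ∃ᶠ z in 𝓝 (0 : ℂ), v z ≠ v 0 := by
    by_contra h
    have hev : ∀ᶠ z in 𝓝 (0 : ℂ), v z = v 0 := by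
      simpa only [Filter.not_frequently, not_not] using h
    have hconst := hUC X J hJ2 hJs v hv hJv 0 hev
    -- then `u` is constant off `0`, hence locally constant at `1`
    have h1 : ∀ᶠ z in 𝓝 (1 : ℂ), u z = u 1 := by
      filter_upwards [isOpen_ne.mem_nhds (one_ne_zero : (1 : ℂ) ≠ 0)] with z hz
      have hz' : u z = v z⁻¹ := by rw [huv z⁻¹ (inv_ne_zero hz), inv_inv]
      have h1' : u 1 = v 1 := by rw [huv 1 one_ne_zero, inv_one]
      rw [hz', h1', hconst z⁻¹, hconst 1]
    exact (NC 1).and_eventually h1 |>.exists.elim fun z hz => hz.1 hz.2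
  -- (1) shifted data in the affine chart
  have huc0 : ∀ c : ℂ, ContMDiff 𝓘(ℝ, ℂ) (𝓡 4) ∞ (fun z : ℂ => u (z + c)) := fun c =>
    contMDiff_comp_add_const hu c
  have huJc0 : ∀ c : ℂ, IsJHolomorphic (𝓡 4) J (fun z : ℂ => u (z + c)) := fun c =>
    isJHolomorphic_comp_add_const hu hJu c
  have hsc : ∀ (n : ℕ) (c : ℂ), ContMDiff 𝓘(ℝ, ℂ) (𝓡 4) ∞ (fun z : ℂ => us n (z + c)) :=
    fun n c => contMDiff_comp_add_const (happ n).1 c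
  have hsJc : ∀ (n : ℕ) (c : ℂ), IsJHolomorphic (𝓡 4) J (fun z : ℂ => us n (z + c)) :=
    fun n c => isJHolomorphic_comp_add_const (happ n).1 (happ n).2.2.2.1 c
  have hsinjc : ∀ (n : ℕ) (c : ℂ), Function.Injective (fun z : ℂ => us n (z + c)) :=
    fun n c a b h => add_right_cancel ((happ n).2.2.2.2.2.1 h)
  have hsimmc : ∀ (n : ℕ) (c z : ℂ),
      Function.Injective (mfderiv 𝓘(ℝ, ℂ) (𝓡 4) (fun z : ℂ => us n (z + c)) z) := by
    intro n c z
    rw [mfderiv_comp_add_const (happ n).1]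
    exact (happ n).2.2.2.2.2.2.1 (z + c)
  have hconvc : ∀ (c : ℂ) (ρ : ℝ), TendstoUniformlyOn (fun n z => e (us n (z + c)))
      (fun z => e (u (z + c))) atTop (Metric.closedBall (0 : ℂ) ρ) :=
    fun c ρ => tendstoUniformlyOn_comp_add_const (fun D _ => hconvU D) c ρ
  -- the approximants in the chart at infinity are injective immersions as well
  have hvs_emb : ∀ n, IsEmbeddedPair (vs n) (us n) := fun n =>
    LeafSwap.isEmbeddedPair_swap (happ n).1 (happ n).2.2.1
      ⟨(happ n).2.2.2.2.2.1, (happ n).2.2.2.2.2.2.1, (happ n).2.2.2.2.2.2.2.1,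
        (happ n).2.2.2.2.2.2.2.2.1⟩
  -- (2) regular points are locally injective
  have LI : ∀ t : ℂ, Function.Injective (mfderiv 𝓘(ℝ, ℂ) (𝓡 4) u t) →
      ∃ ρ : ℝ, 0 < ρ ∧ Set.InjOn u (Metric.ball t ρ) :=
    fun t ht => exists_injOn_ball_of_mfderiv_injective he hde hu ht
  -- (3) critical points are isolated; regular points form an open set
  have CI : ∀ c : ℂ, ∀ᶠ z in 𝓝[≠] c, Function.Injective (mfderiv 𝓘(ℝ, ℂ) (𝓡 4) u z) :=
    fun c => IsJHolomorphic.eventually_injective_mfderiv hJ2 hJs hu hJu (NC c)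
  have CIball : ∀ c : ℂ, ∃ ρ : ℝ, 0 < ρ ∧ ∀ z ∈ Metric.ball c ρ, z ≠ c →
      Function.Injective (mfderiv 𝓘(ℝ, ℂ) (𝓡 4) u z) := by
    intro c
    obtain ⟨ρ, hρ, hb⟩ := Metric.eventually_nhds_iff_ball.1 (eventually_nhdsWithin_iff.1 (CI c))
    exact ⟨ρ, hρ, fun z hz hzc => hb z hz hzc⟩
  have RegOpen : ∀ t : ℂ, Function.Injective (mfderiv 𝓘(ℝ, ℂ) (𝓡 4) u t) →
      ∃ ρ : ℝ, 0 < ρ ∧ ∀ z ∈ Metric.ball t ρ,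
        Function.Injective (mfderiv 𝓘(ℝ, ℂ) (𝓡 4) u z) := by
    intro t ht
    obtain ⟨ρ, hρ, hb⟩ := CIball t
    refine ⟨ρ, hρ, fun z hz => ?_⟩
    by_cases h : z = t
    · rw [h]; exact ht
    · exact hb z hz h
  -- (4) the locus `N₂` of regular parameters with a partner (finite, or the point at infinity)
  set N₂ : Set ℂ := {t | Function.Injective (mfderiv 𝓘(ℝ, ℂ) (𝓡 4) u t) ∧
    ((∃ s, s ≠ t ∧ u s = u t) ∨ v 0 = u t)} with hN₂def
  -- `N₂` is open
  have hNopen : ∀ t ∈ N₂, ∃ ρ : ℝ, 0 < ρ ∧ Metric.ball t ρ ⊆ N₂ := by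
    rintro t ⟨hreg, hpartner⟩
    obtain ⟨ρr, hρr, hρreg⟩ := RegOpen t hreg
    have hreg' : Function.Injective (mfderiv 𝓘(ℝ, ℂ) (𝓡 4) (fun z : ℂ => u (z + t)) 0) := by
      rw [mfderiv_comp_add_const hu, zero_add]; exact hreg
    rcases hpartner with ⟨s, hst, hust⟩ | hinf
    · -- a finite partner `s ≠ t`
      have hd : 0 < ‖s - t‖ / 2 := by
        have : 0 < ‖s - t‖ := norm_pos_iff.2 (sub_ne_zero.2 hst)
        linarith
      have h0 : (fun z : ℂ => u (z + s)) 0 = (fun z : ℂ => u (z + t)) 0 := by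
        simp only [zero_add, hust]
      rcases hInt X J hJ2 hJs (fun z : ℂ => u (z + s)) (fun z : ℂ => u (z + t)) (huc0 s)
        (huJc0 s) (huc0 t) (huJc0 t) h0 hreg' (NCs s) with ⟨ρ₃, hρ₃, hiso⟩ | hco
      · -- isolated: the embedded approximants would meet (positivity / persistence)
        exfalso
        set ρ₄ : ℝ := min ρ₃ (‖s - t‖ / 2) with hρ₄def
        have hρ₄ : 0 < ρ₄ := lt_min hρ₃ hd
        have hiso' : ∀ a ∈ Metric.ball (0 : ℂ) ρ₄, ∀ b ∈ Metric.ball (0 : ℂ) ρ₄,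
            u (a + s) = u (b + t) → a = 0 ∧ b = 0 := fun a ha b hb h =>
          hiso a (Metric.ball_subset_ball (min_le_left _ _) ha) b
            (Metric.ball_subset_ball (min_le_left _ _) hb) h
        have hev := hPos X J hJ2 hJs N e hιe he hde (fun z : ℂ => u (z + s))
          (fun z : ℂ => u (z + t)) (huc0 s) (huJc0 s) (huc0 t) (huJc0 t) h0 hreg' ρ₄ hρ₄ hiso'
          (fun n z => us n (z + s)) (fun n z => us n (z + t)) (fun n => hsc n s)
          (fun n => hsJc n s) (fun n => hsc n t) (fun n => hsJc n t) (hconvc s ρ₄) (hconvc t ρ₄)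
        obtain ⟨n, a, ha, b, hb, hab⟩ := hev.exists
        have heq : a + s = b + t := (happ n).2.2.2.2.2.1 hab
        have h1 : s - t = b - a := by linear_combination heq
        have ha' : ‖a‖ < ‖s - t‖ / 2 :=
          lt_of_lt_of_le (mem_ball_zero_iff.1 ha) (min_le_right _ _)
        have hb' : ‖b‖ < ‖s - t‖ / 2 :=
          lt_of_lt_of_le (mem_ball_zero_iff.1 hb) (min_le_right _ _)
        have : ‖s - t‖ < ‖s - t‖ :=
          calc ‖s - t‖ = ‖b - a‖ := by rw [h1]
            _ ≤ ‖b‖ + ‖a‖ := norm_sub_le b a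
            _ < ‖s - t‖ / 2 + ‖s - t‖ / 2 := add_lt_add hb' ha'
            _ = ‖s - t‖ := by ring
        exact lt_irrefl _ this
      · -- same image germ: every nearby (regular) point has a partner near `s`
        obtain ⟨ρ', hρ', -, hsub⟩ := hco _ hd
        have hρ'' : 0 < min (min ρ' (‖s - t‖ / 2)) ρr := lt_min (lt_min hρ' hd) hρr
        refine ⟨_, hρ'', fun t' ht' => ?_⟩
        have ht'r : t' ∈ Metric.ball t ρr := Metric.ball_subset_ball (min_le_right _ _) ht'
        have ht'1 : ‖t' - t‖ < ρ' := by
          have := Metric.ball_subset_ball ((min_le_left _ _).trans (min_le_left _ _)) ht'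
          rwa [Metric.mem_ball, dist_eq_norm] at this
        have ht'2 : ‖t' - t‖ < ‖s - t‖ / 2 := by
          have := Metric.ball_subset_ball ((min_le_left _ _).trans (min_le_right _ _)) ht'
          rwa [Metric.mem_ball, dist_eq_norm] at this
        have hmem : u t' ∈ (fun z : ℂ => u (z + t)) '' Metric.ball (0 : ℂ) ρ' :=
          ⟨t' - t, mem_ball_zero_iff.2 ht'1, by simp only [sub_add_cancel]⟩
        obtain ⟨σ, hσ, huσ⟩ := hsub hmem
        have hσ1 : ‖σ‖ < ‖s - t‖ / 2 := mem_ball_zero_iff.1 hσ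
        refine ⟨hρreg t' ht'r, Or.inl ⟨σ + s, ?_, huσ⟩⟩
        intro h
        have h2 : s - t = (t' - t) - σ := by rw [← h]; ring
        have : ‖s - t‖ < ‖s - t‖ :=
          calc ‖s - t‖ = ‖(t' - t) - σ‖ := by rw [h2]
            _ ≤ ‖t' - t‖ + ‖σ‖ := norm_sub_le _ _
            _ < ‖s - t‖ / 2 + ‖s - t‖ / 2 := add_lt_add ht'2 hσ1
            _ = ‖s - t‖ := by ring
        exact lt_irrefl _ this
    · -- the partner is the point at infinity: `v 0 = u t`
      have h0 : v 0 = (fun z : ℂ => u (z + t)) 0 := by simp only [zero_add, hinf]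
      -- radius below which `σ ≠ 0`, `‖σ‖ < ρ∞` forces `‖σ⁻¹‖ > ‖t‖ + 1`
      set ρinf : ℝ := (‖t‖ + 2)⁻¹ with hρinfdef
      have hρinf : 0 < ρinf := inv_pos.2 (by positivity)
      have hbig : ∀ σ : ℂ, σ ≠ 0 → ‖σ‖ < ρinf → ‖t‖ + 2 < ‖σ⁻¹‖ := by
        intro σ hσ0 hσ
        rw [norm_inv]
        rw [hρinfdef] at hσ
        have hσpos : 0 < ‖σ‖ := norm_pos_iff.2 hσ0
        calc ‖t‖ + 2 = (‖t‖ + 2)⁻¹⁻¹ := by rw [inv_inv]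
          _ < ‖σ‖⁻¹ := by
            apply (inv_lt_inv₀ (by positivity) hσpos).2
            simpa using hσ
      rcases hInt X J hJ2 hJs v (fun z : ℂ => u (z + t)) hv hJv (huc0 t) (huJc0 t) h0 hreg'
        NCv with ⟨ρ₃, hρ₃, hiso⟩ | hco
      · -- isolated: the approximants `vs n`, `us n (· + t)` would meet near `(0, 0)`
        exfalso
        set ρ₄ : ℝ := min ρ₃ (min 1 ρinf) with hρ₄def
        have hρ₄ : 0 < ρ₄ := lt_min hρ₃ (lt_min one_pos hρinf)
        have hiso' : ∀ a ∈ Metric.ball (0 : ℂ) ρ₄, ∀ b ∈ Metric.ball (0 : ℂ) ρ₄,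
            v a = u (b + t) → a = 0 ∧ b = 0 := fun a ha b hb h =>
          hiso a (Metric.ball_subset_ball (min_le_left _ _) ha) b
            (Metric.ball_subset_ball (min_le_left _ _) hb) h
        have hev := hPos X J hJ2 hJs N e hιe he hde v (fun z : ℂ => u (z + t)) hv hJv (huc0 t)
          (huJc0 t) h0 hreg' ρ₄ hρ₄ hiso' vs (fun n z => us n (z + t)) (fun n => (happ n).2.1)
          (fun n => (happ n).2.2.2.2.1) (fun n => hsc n t) (fun n => hsJc n t)
          (hconvV (Metric.closedBall 0 ρ₄)) (hconvc t ρ₄)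
        obtain ⟨n, a, ha, b, hb, hab⟩ := hev.exists
        by_cases ha0 : a = 0
        · rw [ha0] at hab
          exact (happ n).2.2.2.2.2.2.2.2.1 ⟨b + t, hab.symm⟩
        · rw [(happ n).2.2.1 a ha0] at hab
          have heq : a⁻¹ = b + t := (happ n).2.2.2.2.2.1 hab
          have ha' : ‖a‖ < ρinf := lt_of_lt_of_le (mem_ball_zero_iff.1 ha)
            ((min_le_right _ _).trans (min_le_right _ _))
          have hb' : ‖b‖ < 1 := lt_of_lt_of_le (mem_ball_zero_iff.1 hb)
            ((min_le_right _ _).trans (min_le_left _ _))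
          have h1 := hbig a ha0 ha'
          rw [heq] at h1
          have : ‖b + t‖ ≤ ‖b‖ + ‖t‖ := norm_add_le _ _
          linarith
      · -- same image germ: every nearby (regular) point has a partner (finite or at infinity)
        obtain ⟨ρ', hρ', -, hsub⟩ := hco ρinf hρinf
        have hρ'' : 0 < min (min ρ' 1) ρr := lt_min (lt_min hρ' one_pos) hρr
        refine ⟨_, hρ'', fun t' ht' => ?_⟩
        have ht'r : t' ∈ Metric.ball t ρr := Metric.ball_subset_ball (min_le_right _ _) ht'
        have ht'1 : ‖t' - t‖ < ρ' := by
          have := Metric.ball_subset_ball ((min_le_left _ _).trans (min_le_left _ _)) ht'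
          rwa [Metric.mem_ball, dist_eq_norm] at this
        have ht'2 : ‖t' - t‖ < 1 := by
          have := Metric.ball_subset_ball ((min_le_left _ _).trans (min_le_right _ _)) ht'
          rwa [Metric.mem_ball, dist_eq_norm] at this
        have hmem : u t' ∈ (fun z : ℂ => u (z + t)) '' Metric.ball (0 : ℂ) ρ' :=
          ⟨t' - t, mem_ball_zero_iff.2 ht'1, by simp only [sub_add_cancel]⟩
        obtain ⟨σ, hσ, hvσ⟩ := hsub hmem
        refine ⟨hρreg t' ht'r, ?_⟩
        by_cases hσ0 : σ = 0
        · rw [hσ0] at hvσ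
          exact Or.inr hvσ
        · refine Or.inl ⟨σ⁻¹, ?_, by rw [← huv σ hσ0]; exact hvσ⟩
          intro h
          have h1 := hbig σ hσ0 (mem_ball_zero_iff.1 hσ)
          rw [h] at h1
          have : ‖t'‖ ≤ ‖t' - t‖ + ‖t‖ := by
            calc ‖t'‖ = ‖(t' - t) + t‖ := by rw [sub_add_cancel]
              _ ≤ ‖t' - t‖ + ‖t‖ := norm_add_le _ _
          linarith
  -- `N₂` is closed in the regular set (`helper_limitEmbeddedSpherePartnerClosed`)
  have hNclosed : ∀ t : ℂ, Function.Injective (mfderiv 𝓘(ℝ, ℂ) (𝓡 4) u t) →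
      t ∈ closure N₂ → t ∈ N₂ := by
    intro t hreg htcl
    obtain ⟨ρ, hρ, hinj⟩ := LI t hreg
    obtain ⟨tk, htkN, htk⟩ := mem_closure_iff_seq_limit.1 htcl
    exact ⟨hreg, helper_limitEmbeddedSpherePartnerClosed X u v t ρ tk hu.continuous hv.continuous
      huv hρ hinj (fun k => (htkN k).2) htk⟩
  -- the regular set is preconnected (`helper_limitEmbeddedSphereRegularPreconnected`)
  have hRpre : IsPreconnected {t : ℂ | Function.Injective (mfderiv 𝓘(ℝ, ℂ) (𝓡 4) u t)} :=
    helper_limitEmbeddedSphereRegularPreconnected _ (fun c => (CI c).mono fun z hz => hz) ⟨z₀, hz₀reg⟩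
  -- `N₂` is empty: clopen in the connected regular set, and it misses `z₀`
  have hNempty : ∀ t, t ∉ N₂ := by
    have hsub : {t : ℂ | Function.Injective (mfderiv 𝓘(ℝ, ℂ) (𝓡 4) u t)} ⊆
        N₂ ∪ (closure N₂)ᶜ := by
      intro t hreg
      by_cases h : t ∈ closure N₂
      · exact Or.inl (hNclosed t hreg h)
      · exact Or.inr h
    have hN₂open : IsOpen N₂ := Metric.isOpen_iff.2 hNopen
    have hdisj : Disjoint N₂ (closure N₂)ᶜ :=
      Set.disjoint_compl_right_iff_subset.2 subset_closure
    rcases hRpre.subset_or_subset hN₂open isClosed_closure.isOpen_compl hdisj hsub with h | h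
    · exfalso
      obtain ⟨-, hpart⟩ := h hz₀reg
      rcases hpart with ⟨s, hs, hus⟩ | hinf'
      · exact hs (hz₀inj s hus)
      · exact hz₀inf hinf'
    · intro t ht
      exact h ht.1 (subset_closure ht)
  -- (5) every point of the affine chart is regular (no cusps)
  have hallreg : ∀ c : ℂ, Function.Injective (mfderiv 𝓘(ℝ, ℂ) (𝓡 4) u c) := by
    intro c
    by_contra hc
    obtain ⟨ρc, hρc, hρcreg⟩ := CIball c
    have hinjc : Set.InjOn u (Metric.ball c ρc) := by
      intro a ha b hb hab
      by_contra hne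
      by_cases hac : a = c
      · have hbc : b ≠ c := fun h => hne (hac.trans h.symm)
        exact hNempty b ⟨hρcreg b hb hbc, Or.inl ⟨a, hne, hab⟩⟩
      · exact hNempty a ⟨hρcreg a ha hac, Or.inl ⟨b, fun h => hne h.symm, hab.symm⟩⟩
    have hinj' : Set.InjOn (fun z : ℂ => u (z + c)) (Metric.ball (0 : ℂ) ρc) := by
      intro a ha b hb hab
      have ha' : a + c ∈ Metric.ball c ρc := by
        simpa [Metric.mem_ball, dist_eq_norm] using ha
      have hb' : b + c ∈ Metric.ball c ρc := by
        simpa [Metric.mem_ball, dist_eq_norm] using hb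
      exact add_right_cancel (hinjc ha' hb' hab)
    have himm' : ∀ z ∈ Metric.ball (0 : ℂ) ρc, z ≠ 0 →
        Function.Injective (mfderiv 𝓘(ℝ, ℂ) (𝓡 4) (fun z : ℂ => u (z + c)) z) := by
      intro z hz hz0
      rw [mfderiv_comp_add_const hu]
      refine hρcreg (z + c) ?_ ?_
      · simpa [Metric.mem_ball, dist_eq_norm] using hz
      · simpa using hz0
    have key := hCusp X J hJ2 hJs N e hιe he hde (fun z : ℂ => u (z + c)) (huc0 c) (huJc0 c)
      ρc hρc hinj' himm' (fun n z => us n (z + c)) (fun n => hsc n c) (fun n => hsJc n c)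
      (fun n => hsinjc n c) (fun n => hsimmc n c) (hconvc c ρc)
    rw [mfderiv_comp_add_const hu, zero_add] at key
    exact hc key
  -- (6) conclusions in the affine chart
  have hinjU : Function.Injective u := by
    intro s t h
    by_contra hne
    exact hNempty t ⟨hallreg t, Or.inl ⟨s, hne, h⟩⟩
  have hinfU : v 0 ∉ Set.range u := by
    rintro ⟨t, ht⟩
    exact hNempty t ⟨hallreg t, Or.inr ht.symm⟩
  -- (7) the chart at infinity: `v` is injective, immersive off `0`, hence (no cusp) at `0` too
  have hvinj : Function.Injective v := LeafSwap.injective_infty huv hinjU hinfU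
  have hvimm : ∀ w : ℂ, w ≠ 0 → Function.Injective (mfderiv 𝓘(ℝ, ℂ) (𝓡 4) v w) := by
    intro w hw
    rw [LeafSwap.mfderiv_eq_comp_inv hu huv hw]
    refine fun (ζ : ℂ) (ζ' : ℂ) h => ?_
    have hw2 : (-(w ^ 2)⁻¹ : ℂ) ≠ 0 := neg_ne_zero.mpr (inv_ne_zero (pow_ne_zero 2 hw))
    have h' : mfderiv 𝓘(ℝ, ℂ) (𝓡 4) u w⁻¹
          ((ContinuousLinearMap.smulRight (1 : ℂ →L[ℂ] ℂ) (-(w ^ 2)⁻¹)).restrictScalars ℝ ζ) =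
        mfderiv 𝓘(ℝ, ℂ) (𝓡 4) u w⁻¹
          ((ContinuousLinearMap.smulRight (1 : ℂ →L[ℂ] ℂ) (-(w ^ 2)⁻¹)).restrictScalars ℝ ζ') := h
    have h2 : ((ContinuousLinearMap.smulRight (1 : ℂ →L[ℂ] ℂ) (-(w ^ 2)⁻¹)).restrictScalars ℝ ζ :
        ℂ) = (ContinuousLinearMap.smulRight (1 : ℂ →L[ℂ] ℂ) (-(w ^ 2)⁻¹)).restrictScalars ℝ ζ' :=
      hallreg w⁻¹ h'
    simp only [ContinuousLinearMap.coe_restrictScalars', ContinuousLinearMap.smulRight_apply,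
      one_apply_eq_self, smul_eq_mul] at h2
    exact mul_right_cancel₀ (M₀ := ℂ) hw2 h2
  have hdv : Function.Injective (mfderiv 𝓘(ℝ, ℂ) (𝓡 4) v 0) :=
    hCusp X J hJ2 hJs N e hιe he hde v hv hJv 1 one_pos hvinj.injOn
      (fun z _ hz0 => hvimm z hz0) vs (fun n => (happ n).2.1) (fun n => (happ n).2.2.2.2.1)
      (fun n => (hvs_emb n).injective) (fun n w => (hvs_emb n).imm_u w) (hconvV _)
  exact ⟨hinjU, hallreg, hdv, hinfU⟩

end Summit.SmoothPoincare4.SmoothPoincare4.Theorems.GromovRecognitionRelEnd.CrossCapLaurent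

end
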